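import Summits.NavierStokesRegularity.NavierStokesRegularity.Theorems.LerayQuarterDissipationFiniteDissipationLiouvilleErgodicHull
import Literature.Dynamics.Ergodic.QuasiRegularPoints
import HarnessLib

/-!
# Crux `FiniteDissipationLiouville` (stmt-NavierStokesRegularity-22144), line `birth`:
# INVARIANT MEASURES OF THE SCALING FLOW — a flow-generic critical element (continuous-time
# Cesàro means along the whole scaling orbit)

Helper file (theorems only, `--supports` the crux), the continuous-time companion of
`…ErgodicHull` (lead g12). There the invariant measure was produced for ONE rescaling map
`w ↦ w_λ`; here the scaling FLOW `σ ↦ w_{e^σ}` is shown to act JOINTLY CONTINUOUSLY on the compact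
metrisable hull (equicontinuity over bounded log-scales, `HullCategory.slabPiece_mapsTo_dilate_unif`
of lead g11, plus continuity of each orbit curve), so the tree's continuous-time
Kryloff–Bogoliouboff theorem (`Literature.Dynamics.Ergodic.exists_invariantMeasure_tendsto_timeAverage_semiflow`,
Foias–Manley–Rosa–Temam's time-average measures) gives ONE Borel probability measure on critical
elements invariant under EVERY rescaling `λ ≥ 1`, and Birkhoff's theorem for the time-one map
applied to the averaged observables `∫₀¹ g(w_{e^s}) ds` yields:

* `exists_quasiRegular_flow` — a singular, uniformly recurrent `u ∈ 𝒟_{C,K}` has a scaling limit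
  `W ∈ 𝒟_{C,K}`, again SINGULAR and UNIFORMLY RECURRENT, such that for EVERY tame observable `G`
  (continuous along `𝒟_{C,K}` for uniform convergence on the slab pieces) `G` is bounded on the
  scaling orbit of `W` and the CONTINUOUS-TIME Cesàro means `N⁻¹ ∫₀ᴺ G(W_{e^σ}) dσ` converge
  (`N → ∞` through the integers; the step-free, flow-generic form of the v24 clause).

Honest framing: PORTRAIT / TOOL (no signed-source identity along Leray's similarity flow is known;
verdict FRONTIER unchanged, blocked on `∀ c>1, TypeIDSSLiouville c`). No summit is proved by this
file; Navier–Stokes regularity is NOT proved by anything here.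

References: [KryloffBogoliouboff1937]; [Oxtoby1952] §2; [FMRTTurbulence2001] Ch. IV §2–§3;
[KochNadirashviliSereginSverak2009] §4.
-/

noncomputable section

-- the summit and its single problem share the name (D-0017 nested layout)
set_option linter.dupNamespace false

namespace Summit.NavierStokesRegularity.NavierStokesRegularity.Theorems.FiniteDissipationLiouville.ErgodicHull

open scoped Topology
open MeasureTheory Set Function Filter Metric TopologicalSpace Topology
open Literature.Analysis.FluidPDE
open Summit.NavierStokesRegularity.NavierStokesRegularity.Theorems.RecurrentReductionD

/-- **A FLOW-GENERIC CRITICAL ELEMENT (invariant measures of the scaling flow).** Let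
`u ∈ 𝒟_{C,K}` be SINGULAR at the origin and UNIFORMLY RECURRENT under the scaling flow. Then some
scaling limit `W ∈ 𝒟_{C,K}` of `u` (pointwise limit on the open past of rescalings `u_{l_k}`) is
SINGULAR, UNIFORMLY RECURRENT with the same clause, and FLOW-QUASI-REGULAR: for every observable
`G` of fields continuous along `𝒟_{C,K}` for uniform convergence on the slab pieces, (a) `G` is
bounded on the scaling orbit `{W_c : c > 0}` and (b) the continuous-time Cesàro means
`N⁻¹ ∫₀ᴺ G(W_{e^σ}) dσ` converge as `N → ∞` (joint continuity of the scaling flow on the compact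
metrisable hull; continuous-time Kryloff–Bogoliouboff; Birkhoff for the time-one map on the
averaged observables; persistence of the singularity and minimality).
[cite: KryloffBogoliouboff1937, §1] [cite: FMRTTurbulence2001, Ch. IV §3.1 Prop. 3.1 (time-average measures are invariant)]
[cite: Walters1982, §1.6 Theorem 1.14 (Birkhoff)] -/
theorem exists_quasiRegular_flow {C K : ℝ}
    {u : ℝ → EuclideanSpace ℝ (Fin 3) → EuclideanSpace ℝ (Fin 3)}
    (hu : IsTypeIAncientMild C u)
    (hlaw : ∀ s : ℝ, s < 0 → ∫⁻ x, ‖fderiv ℝ (u s) x‖ₑ ^ 2 ≤ ENNReal.ofReal (K / Real.sqrt (-s)))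
    (hsing : ∀ r > 0, ∀ M : ℝ, ∃ t ∈ Ioo (-(r ^ 2)) (0 : ℝ),
      ∃ x ∈ ball (0 : EuclideanSpace ℝ (Fin 3)) r, M < ‖u t x‖)
    (hrec : ∀ ε > 0, ∀ R > 1, ∃ L > 0, ∀ a : ℝ, ∃ σ ∈ Icc a (a + L),
      ∀ s ∈ Icc (-(R ^ 2)) (-(R⁻¹) ^ 2), ∀ y ∈ closedBall (0 : EuclideanSpace ℝ (Fin 3)) R,
        ‖Real.exp σ • u (Real.exp (2 * σ) * s) (Real.exp σ • y) - u s y‖ ≤ ε) :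
    ∃ W : ℝ → EuclideanSpace ℝ (Fin 3) → EuclideanSpace ℝ (Fin 3),
      IsTypeIAncientMild C W ∧
      (∀ s : ℝ, s < 0 → ∫⁻ x, ‖fderiv ℝ (W s) x‖ₑ ^ 2 ≤ ENNReal.ofReal (K / Real.sqrt (-s))) ∧
      (∀ r > 0, ∀ M : ℝ, ∃ t ∈ Ioo (-(r ^ 2)) (0 : ℝ),
        ∃ x ∈ ball (0 : EuclideanSpace ℝ (Fin 3)) r, M < ‖W t x‖) ∧
      (∀ ε > 0, ∀ R > 1, ∃ L > 0, ∀ a : ℝ, ∃ σ ∈ Icc a (a + L),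
        ∀ s ∈ Icc (-(R ^ 2)) (-(R⁻¹) ^ 2), ∀ y ∈ closedBall (0 : EuclideanSpace ℝ (Fin 3)) R,
          ‖Real.exp σ • W (Real.exp (2 * σ) * s) (Real.exp σ • y) - W s y‖ ≤ ε) ∧
      (∃ l : ℕ → ℝ, (∀ k, 0 < l k) ∧
        ∀ t < 0, ∀ x, Tendsto (fun k => nsRescale (l k) u t x) atTop (𝓝 (W t x))) ∧
      ∀ G : (ℝ → EuclideanSpace ℝ (Fin 3) → EuclideanSpace ℝ (Fin 3)) → ℝ,
        (∀ (v : ℕ → ℝ → EuclideanSpace ℝ (Fin 3) → EuclideanSpace ℝ (Fin 3))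
            (w : ℝ → EuclideanSpace ℝ (Fin 3) → EuclideanSpace ℝ (Fin 3)),
          (∀ j, IsTypeIAncientMild C (v j)) →
          (∀ j, ∀ s : ℝ, s < 0 →
            ∫⁻ x, ‖fderiv ℝ (v j s) x‖ₑ ^ 2 ≤ ENNReal.ofReal (K / Real.sqrt (-s))) →
          IsTypeIAncientMild C w →
          (∀ s : ℝ, s < 0 → ∫⁻ x, ‖fderiv ℝ (w s) x‖ₑ ^ 2 ≤ ENNReal.ofReal (K / Real.sqrt (-s))) →
          (∀ n : ℕ, TendstoUniformlyOn (fun j z => v j z.1 z.2) (fun z => w z.1 z.2) atTop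
            (Icc (-((n : ℝ) + 2)) (-(1 / ((n : ℝ) + 2))) ×ˢ
              closedBall (0 : EuclideanSpace ℝ (Fin 3)) ((n : ℝ) + 2))) →
          Tendsto (fun j => G (v j)) atTop (𝓝 (G w))) →
        (∃ B : ℝ, ∀ c : ℝ, 0 < c → |G (nsRescale c W)| ≤ B) ∧
        ∃ ℓ : ℝ, Tendsto (fun N : ℕ => (N : ℝ)⁻¹ * ∫ σ in (0 : ℝ)..N, G (nsRescale (Real.exp σ) W))
          atTop (𝓝 ℓ) := by
  classical
  -- dilated slab pieces lie in larger slab pieces (`HullCategory.slabPiece_mapsTo_dilate`)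
  have hdil : ∀ {l : ℝ}, 0 < l → ∀ n : ℕ, ∃ m : ℕ, ∀ z ∈ Icc (-((n : ℝ) + 2)) (-(1 / ((n : ℝ) + 2))) ×ˢ
        closedBall (0 : EuclideanSpace ℝ (Fin 3)) ((n : ℝ) + 2),
      ((l ^ 2 * z.1, l • z.2) : ℝ × EuclideanSpace ℝ (Fin 3)) ∈
        Icc (-((m : ℝ) + 2)) (-(1 / ((m : ℝ) + 2))) ×ˢ
          closedBall (0 : EuclideanSpace ℝ (Fin 3)) ((m : ℝ) + 2) := by
    intro l hl n
    obtain ⟨m, hm⟩ := HullCategory.slabPiece_mapsTo_dilate hl n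
    exact ⟨m, fun z hz => hm hz⟩
  -- ## the class, the slab pieces and the model space
  set P : (ℝ → EuclideanSpace ℝ (Fin 3) → EuclideanSpace ℝ (Fin 3)) → Prop := fun p =>
    IsTypeIAncientMild C p ∧
      ∀ s : ℝ, s < 0 → ∫⁻ x, ‖fderiv ℝ (p s) x‖ₑ ^ 2 ≤ ENNReal.ofReal (K / Real.sqrt (-s))
    with hP
  have hPz : ∀ p, P p → ∀ c : ℝ, 0 < c → P (nsRescale c p) := by
    rintro p ⟨h1, h2⟩ c hc
    exact ⟨isTypeIAncientMild_nsRescale h1 hc, dissipationLaw_nsRescale h2 hc⟩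
  set T : ℕ → Set (ℝ × EuclideanSpace ℝ (Fin 3)) := fun n =>
    Icc (-((n : ℝ) + 2)) (-(1 / ((n : ℝ) + 2))) ×ˢ
      closedBall (0 : EuclideanSpace ℝ (Fin 3)) ((n : ℝ) + 2) with hT
  haveI hTc : ∀ n, CompactSpace (T n) := fun n =>
    isCompact_iff_compactSpace.1 (isCompact_slabPiece n)
  have hTsub : ∀ n, T n ⊆ Iio (0:ℝ) ×ˢ (univ : Set (EuclideanSpace ℝ (Fin 3))) := fun n z hz =>
    ⟨neg_of_mem_slabPiece hz, mem_univ _⟩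
  have hres : ∀ (p : ℝ → EuclideanSpace ℝ (Fin 3) → EuclideanSpace ℝ (Fin 3)), P p →
      ∀ n : ℕ, Continuous fun z : T n => p z.1.1 z.1.2 :=
    fun p hp n => continuousOn_iff_continuous_restrict.1 (hp.1.continuousOn_uncurry.mono (hTsub n))
  let Y := (n : ℕ) → C(T n, EuclideanSpace ℝ (Fin 3))
  let Φ : (p : ℝ → EuclideanSpace ℝ (Fin 3) → EuclideanSpace ℝ (Fin 3)) → P p → Y :=
    fun p hp n => ⟨fun z => p z.1.1 z.1.2, hres p hp n⟩
  have hpast_of_eq : ∀ p hp q hq, Φ p hp = Φ q hq → ∀ t : ℝ, t < 0 → ∀ x, p t x = q t x := by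
    intro p hp q hq heq t ht x
    obtain ⟨n, hn⟩ := exists_mem_slabPiece (E := EuclideanSpace ℝ (Fin 3)) ht x
    exact DFunLike.congr_fun (congrFun heq n) ⟨(t, x), hn⟩
  have htend : ∀ (Fj : ℕ → ℝ → EuclideanSpace ℝ (Fin 3) → EuclideanSpace ℝ (Fin 3))
      (hFj : ∀ j, P (Fj j)) (G : ℝ → EuclideanSpace ℝ (Fin 3) → EuclideanSpace ℝ (Fin 3)) (hG : P G),
      Tendsto (fun j => Φ (Fj j) (hFj j)) atTop (𝓝 (Φ G hG)) ↔
        ∀ n, TendstoUniformlyOn (fun j z => Fj j z.1 z.2) (fun z => G z.1 z.2) atTop (T n) := by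
    intro Fj hFj G hG
    rw [tendsto_pi_nhds]
    refine forall_congr' fun n => ?_
    rw [ContinuousMap.tendsto_iff_tendstoUniformly, tendstoUniformlyOn_iff_tendstoUniformly_comp_coe]
    exact Iff.rfl
  have hresc : ∀ (Fj : ℕ → ℝ → EuclideanSpace ℝ (Fin 3) → EuclideanSpace ℝ (Fin 3))
      (G : ℝ → EuclideanSpace ℝ (Fin 3) → EuclideanSpace ℝ (Fin 3)),
      (∀ n, TendstoUniformlyOn (fun j z => Fj j z.1 z.2) (fun z => G z.1 z.2) atTop (T n)) →
      ∀ {c : ℝ}, 0 < c →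
      ∀ n, TendstoUniformlyOn (fun j z => nsRescale c (Fj j) z.1 z.2)
        (fun z => nsRescale c G z.1 z.2) atTop (T n) := by
    intro Fj G h c hc n
    obtain ⟨m, hm⟩ := hdil hc n
    rw [Metric.tendstoUniformlyOn_iff]
    intro ε hε
    filter_upwards [Metric.tendstoUniformlyOn_iff.1 (h m) (ε / c) (div_pos hε hc)] with j hj z hz
    have h1 := hj (c ^ 2 * z.1, c • z.2) (hm z hz)
    rw [nsRescale_apply, nsRescale_apply, dist_smul₀, Real.norm_of_nonneg hc.le]
    calc c * dist (G (c ^ 2 * z.1) (c • z.2)) (Fj j (c ^ 2 * z.1) (c • z.2))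
        < c * (ε / c) := mul_lt_mul_of_pos_left h1 hc
      _ = ε := mul_div_cancel₀ _ hc.ne'
  -- ## the curve of `u` and its hull
  have hu' : P u := ⟨hu, hlaw⟩
  let γ : ℝ → Y := fun σ => Φ (nsRescale (Real.exp σ) u) (hPz u hu' _ (Real.exp_pos σ))
  set H : Set Y := closure (range γ) with hH
  -- KEY: subsequential limits of orbit sequences (KNSS compactness, `orbitLimit`)
  have hkey : ∀ σs : ℕ → ℝ, ∃ (W : ℝ → EuclideanSpace ℝ (Fin 3) → EuclideanSpace ℝ (Fin 3))
      (hW : P W) (ψ : ℕ → ℕ), StrictMono ψ ∧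
      (∀ n : ℕ, TendstoUniformlyOn (fun j z => nsRescale (Real.exp (σs (ψ j))) u z.1 z.2)
        (fun z => W z.1 z.2) atTop (T n)) ∧
      (∀ t < 0, ∀ x, Tendsto (fun j => nsRescale (Real.exp (σs (ψ j))) u t x) atTop (𝓝 (W t x))) ∧
      Tendsto (fun j => γ (σs (ψ j))) atTop (𝓝 (Φ W hW)) := by
    intro σs
    obtain ⟨ψ, hψ, W, hW, hlawW, hWu, hpt⟩ :=
      orbitLimit hu hlaw (fun k => Real.exp (σs k)) (fun k => Real.exp_pos _)
    refine ⟨W, ⟨hW, hlawW⟩, ψ, hψ, hWu, hpt, ?_⟩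
    exact (htend (fun j => nsRescale (Real.exp (σs (ψ j))) u)
      (fun j => hPz u hu' _ (Real.exp_pos _)) W ⟨hW, hlawW⟩).2 hWu
  -- ## compactness of the hull (sequential compactness in the metrisable model)
  have hKc : IsCompact H := by
    letI mY : PseudoMetricSpace Y := pseudoMetrizableSpacePseudoMetric _
    refine IsSeqCompact.isCompact fun x hx => ?_
    have hnear : ∀ k : ℕ, ∃ σ : ℝ, dist (x k) (γ σ) < 1 / ((k : ℝ) + 1) := by
      intro k
      have hk : (0 : ℝ) < 1 / ((k : ℝ) + 1) := by positivity
      obtain ⟨b, hb, hd⟩ := Metric.mem_closure_iff.1 (hx k) (1 / ((k : ℝ) + 1)) hk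
      obtain ⟨σ, rfl⟩ := hb
      exact ⟨σ, hd⟩
    choose σs hσs using hnear
    obtain ⟨W, hW, ψ, hψ, -, -, hlim⟩ := hkey σs
    refine ⟨Φ W hW, ?_, ψ, hψ, ?_⟩
    · exact isClosed_closure.mem_of_tendsto hlim
        (Eventually.of_forall fun j => subset_closure ⟨_, rfl⟩)
    · refine hlim.congr_dist ?_
      have h1 : Tendsto (fun j => 1 / (((ψ j : ℕ) : ℝ) + 1)) atTop (𝓝 0) :=
        (tendsto_one_div_add_atTop_nhds_zero_nat (𝕜 := ℝ)).comp hψ.tendsto_atTop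
      refine squeeze_zero (fun j => dist_nonneg) (fun j => ?_) h1
      rw [dist_comm]
      exact (hσs (ψ j)).le
  -- ## the hull is invariant under rescalings of limits of orbit sequences
  have hclos : ∀ (W : ℝ → EuclideanSpace ℝ (Fin 3) → EuclideanSpace ℝ (Fin 3)) (hW : P W)
      (l : ℕ → ℝ), (∀ k, 0 < l k) →
      (∀ n : ℕ, TendstoUniformlyOn (fun k z => nsRescale (l k) u z.1 z.2) (fun z => W z.1 z.2)
        atTop (T n)) →
      ∀ {c : ℝ} (hc : 0 < c), Φ (nsRescale c W) (hPz W hW c hc) ∈ H := by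
    intro W hW l hl hWu c hc
    have h1 : ∀ n, TendstoUniformlyOn (fun k z => nsRescale (c * l k) u z.1 z.2)
        (fun z => nsRescale c W z.1 z.2) atTop (T n) := by
      intro n
      have h := hresc (fun k => nsRescale (l k) u) W hWu hc n
      refine h.congr (Eventually.of_forall fun k => fun z _ => ?_)
      show nsRescale c (nsRescale (l k) u) z.1 z.2 = nsRescale (c * l k) u z.1 z.2
      rw [show c * l k = l k * c from mul_comm _ _, nsRescale_mul]
    have h2 := (htend (fun k => nsRescale (c * l k) u) (fun k => hPz u hu' _ (mul_pos hc (hl k)))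
      (nsRescale c W) (hPz W hW c hc)).2 h1
    have hΦcongr : ∀ p hp q hq, p = q → Φ p hp = Φ q hq := by
      intro p hp q hq hpq; subst hpq; rfl
    refine mem_closure_of_tendsto h2 (Eventually.of_forall fun k => ⟨Real.log (c * l k), ?_⟩)
    exact hΦcongr _ (hPz u hu' _ (Real.exp_pos _)) _ (hPz u hu' _ (mul_pos hc (hl k)))
      (by rw [Real.exp_log (mul_pos hc (hl k))])
  -- ## every hull point is represented by a singular, uniformly recurrent scaling limit of `u`
  have hrep : ∀ y ∈ H, ∃ (W : ℝ → EuclideanSpace ℝ (Fin 3) → EuclideanSpace ℝ (Fin 3)) (hW : P W),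
      (∀ r > 0, ∀ M : ℝ, ∃ t ∈ Ioo (-(r ^ 2)) (0 : ℝ),
        ∃ x ∈ ball (0 : EuclideanSpace ℝ (Fin 3)) r, M < ‖W t x‖) ∧
      (∀ ε > 0, ∀ R > 1, ∃ L > 0, ∀ a : ℝ, ∃ σ ∈ Icc a (a + L),
        ∀ s ∈ Icc (-(R ^ 2)) (-(R⁻¹) ^ 2), ∀ y ∈ closedBall (0 : EuclideanSpace ℝ (Fin 3)) R,
          ‖Real.exp σ • W (Real.exp (2 * σ) * s) (Real.exp σ • y) - W s y‖ ≤ ε) ∧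
      (∃ l : ℕ → ℝ, (∀ k, 0 < l k) ∧
        (∀ n : ℕ, TendstoUniformlyOn (fun k z => nsRescale (l k) u z.1 z.2) (fun z => W z.1 z.2)
          atTop (T n)) ∧
        ∀ t < 0, ∀ x, Tendsto (fun k => nsRescale (l k) u t x) atTop (𝓝 (W t x))) ∧
      Φ W hW = y := by
    intro y hy
    letI mY : PseudoMetricSpace Y := pseudoMetrizableSpacePseudoMetric _
    obtain ⟨xs, hxs, hxy⟩ := mem_closure_iff_seq_limit.1 hy
    choose σs hσs using hxs
    obtain ⟨W, hW, ψ, hψ, hWu, hpt, hlim⟩ := hkey σs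
    have hxy' : Tendsto (fun j => γ (σs (ψ j))) atTop (𝓝 y) :=
      (hxy.comp hψ.tendsto_atTop).congr fun j => (hσs (ψ j)).symm
    refine ⟨W, hW, ?_, ?_, ⟨fun j => Real.exp (σs (ψ j)), fun j => Real.exp_pos _, hWu, hpt⟩,
      (tendsto_nhds_unique hlim hxy')⟩
    · exact persistent_singularity hu hlaw hsing (fun j => Real.exp (σs (ψ j)))
        (fun j => Real.exp_pos _) W hWu
    · exact HullCategory.recurrent_of_orbitLimit hu hlaw hrec (fun j => Real.exp (σs (ψ j)))
        (fun j => Real.exp_pos _) hW.1 hW.2 hWu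
  -- ## the compact metrisable phase space `X = hull`, the rescaling map on it
  let X := {y : Y // y ∈ H}
  haveI : CompactSpace X := isCompact_iff_compactSpace.1 hKc
  have hγ0 : γ 0 ∈ H := subset_closure ⟨0, rfl⟩
  haveI : Nonempty X := ⟨⟨γ 0, hγ0⟩⟩
  letI mX : MetricSpace X := TopologicalSpace.metrizableSpaceMetric X
  letI : MeasurableSpace X := borel X
  haveI : BorelSpace X := ⟨rfl⟩
  choose rep hrepP hrepS hrepR hrepL hrepΦ using hrep
  -- the representative of a hull point, as a function on `X`
  let ρ : X → (ℝ → EuclideanSpace ℝ (Fin 3) → EuclideanSpace ℝ (Fin 3)) := fun y => rep y.1 y.2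
  have hρP : ∀ y : X, P (ρ y) := fun y => hrepP y.1 y.2
  have hρΦ : ∀ y : X, Φ (ρ y) (hρP y) = y.1 := fun y => hrepΦ y.1 y.2
  have hρmem : ∀ (y : X) {c : ℝ} (hc : 0 < c), Φ (nsRescale c (ρ y)) (hPz _ (hρP y) c hc) ∈ H := by
    intro y c hc
    obtain ⟨l, hl, hWu, -⟩ := hrepL y.1 y.2
    exact hclos (ρ y) (hρP y) l hl hWu hc
  -- the scaling FLOW `φ : ℝ → X → X`
  let φ : ℝ → X → X := fun σ y =>
    ⟨Φ (nsRescale (Real.exp σ) (ρ y)) (hPz _ (hρP y) _ (Real.exp_pos σ)), hρmem y (Real.exp_pos σ)⟩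
  have hΦext : ∀ p hp q hq, (∀ t : ℝ, t < 0 → ∀ x, p t x = q t x) → Φ p hp = Φ q hq := by
    intro p hp q hq hpq
    funext n
    exact ContinuousMap.ext fun z => hpq z.1.1 (neg_of_mem_slabPiece z.2) z.1.2
  -- past agreement of the representative of `φ σ y` with the rescaling of the representative of `y`
  have hφρ : ∀ (σ : ℝ) (y : X), ∀ t : ℝ, t < 0 → ∀ x,
      ρ (φ σ y) t x = nsRescale (Real.exp σ) (ρ y) t x := fun σ y =>
    hpast_of_eq _ (hρP _) _ (hPz _ (hρP y) _ (Real.exp_pos σ)) (hρΦ (φ σ y))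
  have hadd : ∀ s t : ℝ, ∀ y : X, φ (s + t) y = φ s (φ t y) := by
    intro s t y
    apply Subtype.ext
    refine hΦext _ (hPz _ (hρP y) _ (Real.exp_pos _)) _ (hPz _ (hρP _) _ (Real.exp_pos _))
      fun t' ht' x => ?_
    have ht'' : Real.exp s ^ 2 * t' < 0 := mul_neg_of_pos_of_neg (by positivity) ht'
    rw [Real.exp_add, mul_comm, nsRescale_mul, nsRescale_apply (Real.exp s),
      nsRescale_apply (Real.exp s) (ρ (φ t y)), hφρ t y _ ht'']
  -- convergence in `X` = uniform convergence of the representatives on every piece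
  have hXtend : ∀ (y : ℕ → X) (a : X), Tendsto y atTop (𝓝 a) ↔
      ∀ n, TendstoUniformlyOn (fun j z => ρ (y j) z.1 z.2) (fun z => ρ a z.1 z.2) atTop (T n) := by
    intro y a
    rw [tendsto_subtype_rng, ← htend (fun j => ρ (y j)) (fun j => hρP (y j)) (ρ a) (hρP a)]
    simp only [hρΦ]
  -- ## each orbit curve `σ ↦ φ σ y` is continuous (joint continuity on `ℝ × piece`, currying)
  have hcurve : ∀ y : X, Continuous fun σ => φ σ y := by
    intro y
    rw [IsInducing.subtypeVal.continuous_iff]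
    refine continuous_pi fun n => ?_
    have hp := (hρP y).1.continuousOn_uncurry
    have h1 : Continuous fun q : ℝ × T n => Real.exp q.1 := Real.continuous_exp.comp continuous_fst
    have h2 : Continuous fun q : ℝ × T n => ((q.2 : ℝ × EuclideanSpace ℝ (Fin 3))) :=
      continuous_subtype_val.comp continuous_snd
    have hd : Continuous fun q : ℝ × T n =>
        ((Real.exp q.1) ^ 2 * (q.2 : ℝ × EuclideanSpace ℝ (Fin 3)).1,
          Real.exp q.1 • (q.2 : ℝ × EuclideanSpace ℝ (Fin 3)).2) :=
      ((h1.pow 2).mul (continuous_fst.comp h2)).prodMk (h1.smul (continuous_snd.comp h2))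
    have hmaps : ∀ q : ℝ × T n,
        (((Real.exp q.1) ^ 2 * (q.2 : ℝ × EuclideanSpace ℝ (Fin 3)).1,
          Real.exp q.1 • (q.2 : ℝ × EuclideanSpace ℝ (Fin 3)).2) : ℝ × EuclideanSpace ℝ (Fin 3)) ∈
          Iio (0 : ℝ) ×ˢ (univ : Set (EuclideanSpace ℝ (Fin 3))) := fun q =>
      ⟨mul_neg_of_pos_of_neg (pow_pos (Real.exp_pos q.1) 2) (neg_of_mem_slabPiece q.2.2),
        mem_univ _⟩
    have hj : Continuous fun q : ℝ × T n => nsRescale (Real.exp q.1) (ρ y) q.2.1.1 q.2.1.2 :=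
      h1.smul (hp.comp_continuous hd hmaps)
    let F : C(ℝ × T n, EuclideanSpace ℝ (Fin 3)) := ⟨_, hj⟩
    have hF : (fun σ => (φ σ y).1 n) = fun σ => F.curry σ := by
      funext σ
      exact ContinuousMap.ext fun z => rfl
    show Continuous fun σ => (φ σ y).1 n
    rw [hF]
    exact F.curry.continuous
  -- ## joint continuity of the flow on `[0, ∞) × X` (equicontinuity over bounded log-scales)
  have hjoint : ContinuousOn (fun q : ℝ × X => φ q.1 q.2) (Ici 0 ×ˢ univ) := by
    rw [continuousOn_iff_continuous_restrict]
    refine continuous_iff_seqContinuous.2 fun q a hqa => ?_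
    have hq1 : Tendsto (fun j => (q j).1.1) atTop (𝓝 a.1.1) :=
      (continuous_fst.tendsto _).comp ((continuous_subtype_val.tendsto a).comp hqa)
    have hq2 : Tendsto (fun j => (q j).1.2) atTop (𝓝 a.1.2) :=
      (continuous_snd.tendsto _).comp ((continuous_subtype_val.tendsto a).comp hqa)
    show Tendsto (fun j => φ (q j).1.1 (q j).1.2) atTop (𝓝 (φ a.1.1 a.1.2))
    -- split: move the point first (bounded scales, one dilated piece), then the scale
    have hA : Tendsto (fun j => φ (q j).1.1 a.1.2) atTop (𝓝 (φ a.1.1 a.1.2)) :=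
      ((hcurve a.1.2).tendsto _).comp hq1
    rw [hXtend] at hA ⊢
    intro n
    have hl₀ : ∀ᶠ j in atTop, Real.exp (q j).1.1 ≤ Real.exp (a.1.1 + 1) :=
      (hq1.eventually (ge_mem_nhds (lt_add_one _))).mono fun j hj => Real.exp_le_exp.2 hj
    obtain ⟨m, -, hm⟩ := HullCategory.slabPiece_mapsTo_dilate_unif (Real.exp (a.1.1 + 1)) n
    have hB := (hXtend (fun j => (q j).1.2) a.1.2).1 hq2 m
    have hA' := hA n
    rw [Metric.tendstoUniformlyOn_iff] at hA' hB ⊢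
    intro ε hε
    have hL : 0 < Real.exp (a.1.1 + 1) := Real.exp_pos _
    filter_upwards [hA' (ε / 2) (half_pos hε), hB (ε / 2 / Real.exp (a.1.1 + 1)) (by positivity),
      hl₀] with j hjA hjB hjl z hz
    have h1 : (1 : ℝ) ≤ Real.exp (q j).1.1 := Real.one_le_exp (q j).2.1
    have hzm := hm (Real.exp (q j).1.1) h1 hjl hz
    have e1 : ρ (φ (q j).1.1 (q j).1.2) z.1 z.2 =
        Real.exp (q j).1.1 • ρ (q j).1.2 (Real.exp (q j).1.1 ^ 2 * z.1) (Real.exp (q j).1.1 • z.2) :=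
      hφρ _ _ z.1 (neg_of_mem_slabPiece hz) z.2
    have e2 : ρ (φ (q j).1.1 a.1.2) z.1 z.2 =
        Real.exp (q j).1.1 • ρ a.1.2 (Real.exp (q j).1.1 ^ 2 * z.1) (Real.exp (q j).1.1 • z.2) :=
      hφρ _ _ z.1 (neg_of_mem_slabPiece hz) z.2
    have hmid : dist (ρ (φ (q j).1.1 a.1.2) z.1 z.2) (ρ (φ (q j).1.1 (q j).1.2) z.1 z.2) < ε / 2 := by
      rw [e1, e2, dist_smul₀, Real.norm_of_nonneg (Real.exp_pos _).le]
      have h3 := hjB (Real.exp (q j).1.1 ^ 2 * z.1, Real.exp (q j).1.1 • z.2) hzm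
      calc Real.exp (q j).1.1 * dist (ρ a.1.2 (Real.exp (q j).1.1 ^ 2 * z.1) (Real.exp (q j).1.1 • z.2))
            (ρ (q j).1.2 (Real.exp (q j).1.1 ^ 2 * z.1) (Real.exp (q j).1.1 • z.2))
          < Real.exp (q j).1.1 * (ε / 2 / Real.exp (a.1.1 + 1)) :=
            mul_lt_mul_of_pos_left h3 (Real.exp_pos _)
        _ ≤ Real.exp (a.1.1 + 1) * (ε / 2 / Real.exp (a.1.1 + 1)) :=
            mul_le_mul_of_nonneg_right hjl (by positivity)
        _ = ε / 2 := mul_div_cancel₀ _ hL.ne'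
    calc dist (ρ (φ a.1.1 a.1.2) z.1 z.2) (ρ (φ (q j).1.1 (q j).1.2) z.1 z.2)
        ≤ dist (ρ (φ a.1.1 a.1.2) z.1 z.2) (ρ (φ (q j).1.1 a.1.2) z.1 z.2) +
            dist (ρ (φ (q j).1.1 a.1.2) z.1 z.2) (ρ (φ (q j).1.1 (q j).1.2) z.1 z.2) := dist_triangle _ _ _
      _ < ε / 2 + ε / 2 := add_lt_add (hjA z hz) hmid
      _ = ε := by ring
  have h0 : ∀ y : X, φ 0 y = y := by
    intro y
    apply Subtype.ext
    show Φ (nsRescale (Real.exp 0) (ρ y)) (hPz _ (hρP y) _ (Real.exp_pos 0)) = y.1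
    rw [← hρΦ y]
    exact hΦext _ (hPz _ (hρP y) _ (Real.exp_pos 0)) _ (hρP y) fun t ht x => by
      rw [Real.exp_zero, nsRescale_one]
  -- ## a quasi-regular point of the semiflow (Kryloff–Bogoliouboff + Birkhoff, Oxtoby 1952 (2.2))
  obtain ⟨y₀, hall⟩ := Literature.Dynamics.Ergodic.exists_quasiRegularPt_semiflow hjoint
    (fun s t _ _ y => hadd s t y) h0
  -- ## the flow-generic element
  set W := ρ y₀ with hWdef
  refine ⟨W, (hρP y₀).1, (hρP y₀).2, hrepS _ y₀.2, hrepR _ y₀.2, ?_, fun G hG => ?_⟩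
  · obtain ⟨l, hl, -, hpt⟩ := hrepL _ y₀.2
    exact ⟨l, hl, hpt⟩
  have hGeq : ∀ a b, P a → P b → (∀ t : ℝ, t < 0 → ∀ x, a t x = b t x) → G a = G b := by
    intro a b ha hb hab
    have h1 : Tendsto (fun _ : ℕ => G a) atTop (𝓝 (G b)) := by
      refine hG (fun _ => a) b (fun _ => ha.1) (fun _ => ha.2) hb.1 hb.2 fun n => ?_
      rw [Metric.tendstoUniformlyOn_iff]
      intro ε hε
      refine Eventually.of_forall fun j z hz => ?_
      rw [hab z.1 (neg_of_mem_slabPiece hz) z.2, dist_self]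
      exact hε
    exact tendsto_nhds_unique tendsto_const_nhds h1
  have hĜc : Continuous fun y : X => G (ρ y) := by
    refine continuous_iff_seqContinuous.2 fun y a hya => ?_
    exact hG (fun j => ρ (y j)) (ρ a) (fun j => (hρP (y j)).1) (fun j => (hρP (y j)).2)
      (hρP a).1 (hρP a).2 ((hXtend y a).1 hya)
  let Ĝ : C(X, ℝ) := ⟨fun y => G (ρ y), hĜc⟩
  refine ⟨⟨‖Ĝ‖, fun c hc => ?_⟩, ?_⟩
  · let yc : X := ⟨Φ (nsRescale c W) (hPz _ (hρP y₀) c hc), hρmem y₀ hc⟩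
    have h1 : G (nsRescale c W) = Ĝ yc := by
      refine hGeq _ _ (hPz _ (hρP y₀) c hc) (hρP yc) fun t ht x => ?_
      exact (hpast_of_eq _ (hρP yc) _ (hPz _ (hρP y₀) c hc) (hρΦ yc) t ht x).symm
    rw [h1, ← Real.norm_eq_abs]
    exact Ĝ.norm_coe_le_norm yc
  · obtain ⟨ℓ, hℓ⟩ := hall Ĝ
    refine ⟨ℓ, hℓ.congr fun N => ?_⟩
    congr 1
    refine intervalIntegral.integral_congr fun σ _ => ?_
    show G (ρ (φ σ y₀)) = G (nsRescale (Real.exp σ) W)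
    exact hGeq _ _ (hρP _) (hPz _ (hρP y₀) _ (Real.exp_pos σ)) (hφρ σ y₀)

end Summit.NavierStokesRegularity.NavierStokesRegularity.Theorems.FiniteDissipationLiouville.ErgodicHull

end
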